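import Literature.Barriers.CriticalPhenomena.PlaquetteWalkHoleRootCutLaw
import HarnessLib

/-!
# Barrier catalogue (SAWScalingLimit): THE MARKING LAW — a cut with exactly two live edges, both sides of one rhombus, forces
every wound under-walk to double-visit that rhombus through two corners of one kind (LAW L's kills as cases of the cut law)

Leaf of `PlaquetteWalkHoleRootCutLaw` (the cut law: along any lattice cut from the lower corner of the root edge to beyond the
domain, a wound class-`B2a` UNDER-walk crosses an edge with its PREFIX before its EXCURSION crosses a later one; dead edges are
crossed by nobody). Setting as there: root plaquette `w` rooted at `W`, hole `holeFaceW w ∉ D`, far cell `farW w`.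

§1 ★★★★ `ΩG.prefix_and_exit_of_twoLive_cut` — LOCALISATION: if all edges of such a cut are dead except the `i`-th and the
`k`-th (`i < k`), then every wound under-walk has its PREFIX crossing the `i`-th edge and a slot of its EXCURSION polygon
exiting through the `k`-th edge.
§2 ★★ arc extraction: a prefix mid-edge `g.side s` (`g ≠ farW w`) is an end of a prefix ARC in `g`, of index `≤ F − 1`
(`ΩG.exists_prefix_arc_of_nth_eq`); an exit mid-edge `g.side t` of a slot is an end of an EXCURSION arc in `g`, of index
`≥ F + 1` (`ΩG.exists_excursion_arc_of_exit_eq`); ★ `YBWalk.two_le_length_kindsIn_of_two_arcs` (two arcs in one rhombus ⇒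
its kind list has two entries, hence (`kindsIn_shape`) is `[corner, corner]` or `[coCorner, coCorner]`).
§3 ★★★★★ `ΩG.kindsIn_eq_of_twoLive_cut` — **THE MARKING LAW**: if the two live edges of the cut are two different sides
`g.side s`, `g.side t` of ONE rhombus `g ≠ farW w`, every wound under-walk carries TWO ARCS in `g` — a prefix arc through `s`
and an excursion arc through `t`, with four distinct ends — so `kindsIn g = [corner, corner]` when `{s, t}` is `{N, E}` or
`{S, W}` (the free corners are the two `θ`-corners: ★★★★★ `ΩG.kindsIn_eq_corner_corner_of_twoLive_cut`, the walk is
`w₁`-MARKED off the far cell, `ΩG.not_W1FreeOff_of_twoLive_cut`) and `[coCorner, coCorner]` when `{s, t}` is `{N, W}` or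
`{S, E}` (★★★★★ `ΩG.kindsIn_eq_coCorner_coCorner_of_twoLive_cut`, `w₂`-MARKED, `ΩG.not_W2FreeOff_of_twoLive_cut`); for
opposite sides one of the two.
§4 LAW L's two under-route kills as instances (general `D`): ★★★★★ `ΩG.kindsIn_rootS_eq_of_wound_under_killSE_column` — `K_S1 =
killSE w` absent, the west sides of column `w.1 + 1` dead from the kill row down to a floor: the cut `[w.S, pocketSE.W, K_S1.W,
…]` has the two live edges `rootS.N`, `rootS.E` ⇒ every wound under-walk doubles `rootS w` through its two `θ`-corners
(`w₁`-kill; the parent files `StructuralKill` §11 / `EastQuadrant` / `KillSignSchema` reach this through the eastern parity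
chain with column clauses); ★★★★★ `ΩG.kindsIn_farSW_eq_of_wound_under_killSW_column` — `K_S2 = killSW w` absent, the west sides
of the far cell's column dead below the kill row down to a floor: the cut `[hole.S, holeS.W, farSW.S, K_S2.E, …]` has the two
live edges `farSW.E`, `farSW.S` ⇒ every wound under-walk doubles `farSW w` through its two `(π − θ)`-corners (`w₂`-kill;
`StructuralKillQuadrant` §2 by the quadrant parity); the WALL variants `ΩG.kindsIn_rootS_eq_of_AJ_ne_zero_under_killSE_eastWall`
(cut `[w.S, pocketSE.W, K_S1.W, K_S1.S]` out through the east wall) and `ΩG.kindsIn_farSW_eq_of_AJ_ne_zero_under_killSW_westWall`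
(cut `[hole.S, holeS.W, farSW.S, K_S2.E, K_S2.S]` out through the west wall); wound forms for either orientation of the winding
witness (`ΩG.not_W1FreeOff_farW_of_wound_under_killSE_column/eastWall`, `ΩG.not_W2FreeOff_farW_of_wound_under_killSW_column/westWall`).
§5 Boxes, ANY further defects `S ∋ h` missing the far cell: ★★★★★ `lawL_box_killSE_wall_under_w1_killed` (`K_S1` removed with
`h.2 = 2` or `h.1 + 3 = m` ⇒ the under route is `w₁`-killed) and ★★★★★ `lawL_box_killSW_wall_under_w2_killed` (`K_S2` removed with
`h.2 = 2` or `h.1 = 2` ⇒ `w₂`-killed) — the (⇐) halves of the lane's `lawL_box_under_w1/w2_killed_iff` (`PlaquetteWalkHoleRootLawLDichotomy`,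
`S = [h, K]`) for every defect list. With `PlaquetteWalkHoleRootCutLaw` §2 this is the lane's LAW L in one sentence: along a cut
from the lower corner of the root edge, `≤ 1` live edge EMPTIES the under route, exactly `2` live edges on one rhombus MARK it
(kill one freeness class), and the harmless cells are those leaving `≥ 2` live edges in general position on every cut.

Not in print; venture lane «pcv-sawmu», seat b-step0 gen 29 (FINDING-YB-KILL-FORCED-ZEROS §28).

References: A. Glazman, I. Manolescu, arXiv:1708.00395v3, §1 (Fig. 1: the six local configurations and their weights
`u₁, u₂, v, w₁, w₂`; Fig. 2; the remark after eq. (1)), §2.1, Lemma 2.1 [GlazmanManolescu2019]; A. Glazman, Electron. Commun.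
Probab. 20 (2015) no. 86, Lemma 3.1, proof pp. 6–7 [Glazman2015WeightedSAW]; R. Courant, H. Robbins, *What is Mathematics?*
(1941/1958), Ch. V Appendix §2 (the even–odd rule) [CourantRobbins1958]; L. V. Ahlfors, *Complex Analysis*, 3rd ed. (1979),
Ch. 4 §2.1 [AhlforsCA1979].
-/

noncomputable section

open Set Function Complex
open Literature.Topology.PlaneTopology

namespace Literature.Probability.RandomPlanarGeometry.SAW.YangBaxter

open Real

open private fc_fh fc_ne from Literature.Probability.RandomPlanarGeometry.YangBaxterSAWGeneralDomain
open private len_eq side_jOut from Literature.Probability.RandomPlanarGeometry.YangBaxterSAWExcursionJordan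

namespace YBWalk

variable {D : Set Face} {a z : MidEdge}

/-- ★ **Two arcs of a walk in one rhombus give its kind list two entries.** [cite: GlazmanManolescu2019, §1, Fig. 1] -/
theorem two_le_length_kindsIn_of_two_arcs (γ : YBWalk D a z) {m m' : ℕ} (hm : m < γ.arcs.length)
    (hm' : m' < γ.arcs.length) (hmm' : m < m') (hf : γ.fc m' = γ.fc m) : 2 ≤ (γ.kindsIn (γ.fc m)).length := by
  set f := γ.fc m with hfdef
  set F : MidEdge × MidEdge → Option ArcKind := fun p => if arcFace p = some f then arcKindOf p else none with hF
  have hsome : ∀ {n : ℕ} (hn : n < γ.arcs.length), γ.fc n = f → ∃ k, F γ.arcs[n] = some k := by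
    intro n hn hfn
    obtain ⟨h1, h2⟩ := YBWalk.arcKindOf_getElem hn
    rw [hfn] at h1
    exact ⟨arcKind (γ.sIn n) (γ.sOut n), by simp only [hF, if_pos h1, h2]⟩
  have hsub : [γ.arcs[m], γ.arcs[m']].Sublist γ.arcs := by
    have h1 : [γ.arcs[m]].Sublist (γ.arcs.take m') := by
      rw [List.singleton_sublist]
      exact List.mem_iff_getElem.2 ⟨m, by rw [List.length_take]; omega, List.getElem_take⟩
    have h2 : [γ.arcs[m']].Sublist (γ.arcs.drop m') := by
      rw [List.singleton_sublist]
      exact List.mem_iff_getElem.2 ⟨0, by rw [List.length_drop]; omega, by rw [List.getElem_drop]; simp⟩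
    have := h1.append h2
    rwa [List.take_append_drop] at this
  obtain ⟨k1, e1⟩ := hsome hm rfl
  obtain ⟨k2, e2⟩ := hsome hm' hf
  have := (hsub.filterMap F).length_le
  rw [List.filterMap_cons_some e1, List.filterMap_cons_some e2, List.filterMap_nil] at this
  rw [YBWalk.kindsIn]
  simpa using this

/-- Two arcs in one rhombus: its kind list is `[corner, corner]` or `[coCorner, coCorner]`.
[cite: GlazmanManolescu2019, §1, Fig. 1 (two arcs in a rhombus sit at two corners of one kind)] -/
theorem kindsIn_eq_pair_of_two_arcs (γ : YBWalk D a z) {m m' : ℕ} (hm : m < γ.arcs.length)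
    (hm' : m' < γ.arcs.length) (hmm' : m < m') (hf : γ.fc m' = γ.fc m) :
    γ.kindsIn (γ.fc m) = [.corner, .corner] ∨ γ.kindsIn (γ.fc m) = [.coCorner, .coCorner] := by
  have h2 := γ.two_le_length_kindsIn_of_two_arcs hm hm' hmm' hf
  rcases γ.kindsIn_shape (γ.fc m) with e | e | e | e | e | e <;> rw [e] at h2 ⊢ <;> simp at h2 ⊢

/-- With two arcs in one rhombus, each of them has the kind of the pair. [cite: GlazmanManolescu2019, §1, Fig. 1] -/
theorem arcKind_eq_of_two_arcs (γ : YBWalk D a z) {m m' : ℕ} (hm : m < γ.arcs.length)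
    (hm' : m' < γ.arcs.length) (hmm' : m < m') (hf : γ.fc m' = γ.fc m) {n : ℕ} (hn : n < γ.arcs.length)
    (hfn : γ.fc n = γ.fc m) :
    (γ.kindsIn (γ.fc m) = [.corner, .corner] ∧ arcKind (γ.sIn n) (γ.sOut n) = .corner) ∨
      (γ.kindsIn (γ.fc m) = [.coCorner, .coCorner] ∧ arcKind (γ.sIn n) (γ.sOut n) = .coCorner) := by
  have hmem := γ.arcKind_mem_kindsIn hn
  rw [hfn] at hmem
  rcases γ.kindsIn_eq_pair_of_two_arcs hm hm' hmm' hf with e | e <;> rw [e] at hmem ⊢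
  · left; exact ⟨rfl, by simpa using hmem⟩
  · right; exact ⟨rfl, by simpa using hmem⟩

end YBWalk

namespace ΩG

variable {D : Set Face} {w : Face} {ω : ΩG D (w.side .W) (farW w)}

/-! ## §1 Localisation on a cut with exactly two live edges -/

/-- ★★★★ **LOCALISATION.** Hole absent; a lattice cut `q 0 = (w.1, w.2), …, q K` ending beyond the domain, edges neither the
hole's `W` side nor the root edge, ALL DEAD EXCEPT the `i`-th and the `k`-th, `i < k`. Then every class-`B2a` under-walk at the
far cell whose excursion polygon winds around the root has its PREFIX crossing the `i`-th edge and a slot of its excursion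
polygon exiting through the `k`-th edge. [cite: CourantRobbins1958, Ch. V Appendix §2 (the even–odd rule)]
[cite: AhlforsCA1979, Ch. 4 §2.1 (index of a point)] [cite: Glazman2015WeightedSAW, Lemma 3.1 (proof, pp. 6–7)] -/
theorem prefix_and_exit_of_twoLive_cut (hh : holeFaceW w ∉ D) (hr : RootedFace D (w.side .W) (farW w)) (h : ω.IsB2a)
    (hS : ω.2.firstSideG = .S) {q : ℕ → ℤ × ℤ} {c : ℕ → Face} {s : ℕ → Side} {K : ℕ} (hq0 : q 0 = w)
    (hseg : ∀ k, k < K → segment ℝ (toC (cornerPt (q k))) (toC (cornerPt (q (k + 1)))) = sideSeg (c k) (s k))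
    (h1 : ∀ k, k < K → (c k).side (s k) ≠ (holeFaceW w).side .W) (h2 : ∀ k, k < K → (c k).side (s k) ≠ w.side .W)
    (hexit : (∀ f : Face, f ∈ D → f.1 < (q K).1) ∨ (∀ f : Face, f ∈ D → (q K).1 ≤ f.1) ∨
      (∀ f : Face, f ∈ D → (q K).2 ≤ f.2) ∨ (∀ f : Face, f ∈ D → f.2 < (q K).2))
    {i k : ℕ} (hik : i < k)
    (hdead : ∀ k', k' < K → k' ≠ i → k' ≠ k →
      ((c k').side (s k')).faces.1 ∉ D ∨ ((c k').side (s k')).faces.2 ∉ D)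
    (hA : ω.AJ hr h (toC (midPt (w.side .W))) ≠ 0) :
    (∃ i', 1 ≤ i' ∧ i' ≤ ω.2.firstHitG ∧ ω.2.nth i' = (c i).side (s i)) ∧
      ∃ j, j < ω.Mv ∧ (ω.jFace h j).side (ω.jOut hr h j) = (c k).side (s k) := by
  have hF := ω.fh_lt h
  obtain ⟨i₁, k₁, hik₁, hk₁, ⟨i', hi1, hiF, e⟩, j, hj, e'⟩ :=
    exists_prefix_lt_exit_on_cut hh hr h hS hq0 hseg h1 h2 (AJ_cornerPt_eq_zero_of_beyond hr h hexit) hA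
  -- both crossed edges are live, hence among `{i, k}`; the order forces `i₁ = i`, `k₁ = k`
  have hl1 := ω.2.door_nth (j := i') (by omega) (by omega)
  rw [e] at hl1
  have hl2 := exit_faces_mem hr h hj
  rw [e'] at hl2
  have hi₁ : i₁ = i ∨ i₁ = k := by
    by_contra hn; push Not at hn
    rcases hdead i₁ (by omega) hn.1 hn.2 with hd | hd
    · exact hd hl1.1
    · exact hd hl1.2
  have hk₁' : k₁ = i ∨ k₁ = k := by
    by_contra hn; push Not at hn
    rcases hdead k₁ hk₁ hn.1 hn.2 with hd | hd
    · exact hd hl2.1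
    · exact hd hl2.2
  have ei : i₁ = i := by rcases hi₁ with e1 | e1 <;> rcases hk₁' with e2 | e2 <;> omega
  have ek : k₁ = k := by rcases hi₁ with e1 | e1 <;> rcases hk₁' with e2 | e2 <;> omega
  subst ei; subst ek
  exact ⟨⟨i', hi1, hiF, e⟩, j, hj, e'⟩

/-! ## §2 Arc extraction: a crossed side of a rhombus is an end of an arc in it -/

/-- A face having the mid-edge `e` as a side is one of the two faces of `e`. [cite: GlazmanManolescu2019, §1 (the lattice of rhombi and its mid-edges)] -/
private theorem face_of_side_eqM {F : Face} {x : Side} {e : MidEdge} (hx : F.side x = e) : F = e.faces.1 ∨ F = e.faces.2 :=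
  (Face.exists_side_eq_iff F e).1 ⟨x, hx⟩

/-- Three faces of one mid-edge: if `g`, `F₁`, `F₂` all have `e` as a side and `F₁ ≠ F₂`, `g ≠ F₁`, then `g = F₂`.
[cite: GlazmanManolescu2019, §1 (the lattice of rhombi and its mid-edges)] -/
private theorem third_face {g F₁ F₂ A B : Face} (hg : g = A ∨ g = B) (h1 : F₁ = A ∨ F₁ = B) (h2 : F₂ = A ∨ F₂ = B)
    (hne : F₁ ≠ F₂) (hg1 : g ≠ F₁) : g = F₂ := by
  rcases hg with hg | hg <;> rcases h1 with h1 | h1 <;> rcases h2 with h2 | h2 <;>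
    first
    | exact absurd (h1.trans h2.symm) hne
    | exact absurd (hg.trans h1.symm) hg1
    | exact hg.trans h2.symm

/-- ★★ **A mid-edge of the walk that is a side of the rhombus `g` is an end of an arc of the walk in `g`**: if
`nth n = g.side x` with `1 ≤ n < length`, then the arc before or the arc after that mid-edge lies in `g` and has `x` as an
end. [cite: Glazman2015WeightedSAW, Lemma 3.1 (proof, pp. 6–7: the classes of walks through a rhombus)] -/
theorem exists_arc_of_nth_eq {n : ℕ} (hn1 : 1 ≤ n) (hn : n < ω.2.arcs.length) {g : Face} {x : Side}
    (e : ω.2.nth n = g.side x) :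
    ∃ m, (m = n - 1 ∨ m = n) ∧ ω.2.fc m = g ∧ (ω.2.sIn m = x ∨ ω.2.sOut m = x) := by
  obtain ⟨hin, -, -⟩ := ω.2.side_sIn_nth (i := n) hn
  obtain ⟨-, hout, -⟩ := ω.2.side_sIn_nth (i := n - 1) (by omega)
  rw [show n - 1 + 1 = n by omega, e] at hout
  rw [e] at hin
  have hsucc : ω.2.fc (n - 1) ≠ ω.2.fc (n - 1 + 1) := YBWalk.fc_succ_ne (by omega)
  rw [show n - 1 + 1 = n by omega] at hsucc
  rcases face_of_side_eqM hin with e1 | e1 <;> rcases face_of_side_eqM hout with e2 | e2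
  · exact absurd (e2.trans e1.symm) hsucc
  · rcases face_of_side_eqM (rfl : g.side x = g.side x) with eg | eg
    · exact ⟨n, Or.inr rfl, e1.trans eg.symm,
        Or.inl (Face.side_injective g (by rw [e1.trans eg.symm] at hin; exact hin))⟩
    · exact ⟨n - 1, Or.inl rfl, e2.trans eg.symm,
        Or.inr (Face.side_injective g (by rw [e2.trans eg.symm] at hout; exact hout))⟩
  · rcases face_of_side_eqM (rfl : g.side x = g.side x) with eg | eg
    · exact ⟨n - 1, Or.inl rfl, e2.trans eg.symm,
        Or.inr (Face.side_injective g (by rw [e2.trans eg.symm] at hout; exact hout))⟩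
    · exact ⟨n, Or.inr rfl, e1.trans eg.symm,
        Or.inl (Face.side_injective g (by rw [e1.trans eg.symm] at hin; exact hin))⟩
  · exact absurd (e2.trans e1.symm) hsucc

/-- ★★ **A PREFIX mid-edge that is a side of a rhombus other than the far cell is an end of a prefix ARC in it**, of index
`≤ F − 1`. [cite: Glazman2015WeightedSAW, Lemma 3.1 (proof, pp. 6–7: the classes of walks through a rhombus)] -/
theorem exists_prefix_arc_of_nth_eq (hr : RootedFace D (w.side .W) (farW w)) (h : ω.IsB2a) {i' : ℕ} (hi1 : 1 ≤ i')
    (hiF : i' ≤ ω.2.firstHitG) {g : Face} (hg : g ≠ farW w) {x : Side} (e : ω.2.nth i' = g.side x) :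
    ∃ m, m + 1 ≤ ω.2.firstHitG ∧ ω.2.fc m = g ∧ (ω.2.sIn m = x ∨ ω.2.sOut m = x) := by
  have hF := ω.fh_lt h
  obtain ⟨m, hm, hfm, hx⟩ := exists_arc_of_nth_eq (ω := ω) hi1 (by omega) e
  refine ⟨m, ?_, hfm, hx⟩
  rcases hm with em | em
  · omega
  · -- `m = i' = F` would put the arc in the far cell
    by_contra hc
    have emF : m = ω.2.firstHitG := by omega
    rw [emF, (fc_fh ω hr h).1] at hfm
    exact hg hfm.symm

/-- ★★ **An EXIT mid-edge of a slot that is a side of a rhombus other than the far cell is an end of an EXCURSION ARC in it**,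
of index `≥ F + 1` (and `< length`). [cite: Glazman2015WeightedSAW, Lemma 3.1 (proof, pp. 6–7: the classes of walks through a rhombus)] -/
theorem exists_excursion_arc_of_exit_eq (hr : RootedFace D (w.side .W) (farW w)) (h : ω.IsB2a) {j : ℕ} (hj : j < ω.Mv)
    {g : Face} (hg : g ≠ farW w) {x : Side} (e : (ω.jFace h j).side (ω.jOut hr h j) = g.side x) :
    ∃ m, ω.2.firstHitG + 1 ≤ m ∧ m < ω.2.arcs.length ∧ ω.2.fc m = g ∧ (ω.2.sIn m = x ∨ ω.2.sOut m = x) := by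
  have hF := ω.fh_lt h
  have hlen : ω.2.arcs.length = ω.2.firstHitG + ω.Mv := len_eq h
  rw [side_jOut (hr := hr) h hj] at e
  rcases Nat.lt_or_ge (ω.2.firstHitG + j + 1) ω.2.arcs.length with hlt | hge
  · obtain ⟨m, hm, hfm, hx⟩ := exists_arc_of_nth_eq (ω := ω) (by omega) hlt e
    refine ⟨m, ?_, by rcases hm with em | em <;> omega, hfm, hx⟩
    rcases hm with em | em
    · -- `m = F + j`: for `j = 0` this is the far cell
      by_contra hc
      have emF : m = ω.2.firstHitG := by omega
      rw [emF, (fc_fh ω hr h).1] at hfm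
      exact hg hfm.symm
    · omega
  · -- the last mid-edge: the return side of the far cell, an end of the last arc
    have hM := ω.three_le_Mv hr h
    have heq : ω.2.firstHitG + j + 1 = ω.2.arcs.length := by omega
    rw [heq] at e
    obtain ⟨-, hout, -⟩ := ω.2.side_sIn_nth (i := ω.2.arcs.length - 1) (by omega)
    rw [show ω.2.arcs.length - 1 + 1 = ω.2.arcs.length by omega, e] at hout
    have hne : ω.2.fc (ω.2.arcs.length - 1) ≠ farW w := fc_ne ω hr h (by omega) (by omega)
    have e2 : (farW w).side ω.1 = g.side x := by rw [← e]; exact ω.2.nth_length.symm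
    have hg' := third_face (face_of_side_eqM (rfl : g.side x = g.side x)) (face_of_side_eqM e2)
      (face_of_side_eqM hout) hne.symm hg
    exact ⟨ω.2.arcs.length - 1, by omega, by omega, hg'.symm,
      Or.inr (Face.side_injective g (by rw [← hg'] at hout; exact hout))⟩

/-! ## §3 The marking law -/

/-- Side bookkeeping: for `{x, y} = {N, E}` or `{S, W}`, an arc through `x` avoiding `y` is not a co-corner arc.
[cite: GlazmanManolescu2019, §1, Fig. 1] -/
private theorem arcKind_ne_coCorner_of_adj : ∀ x y u v : Side,
    ((x = .N ∧ y = .E) ∨ (x = .E ∧ y = .N) ∨ (x = .S ∧ y = .W) ∨ (x = .W ∧ y = .S)) →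
      (u = x ∨ v = x) → u ≠ y → v ≠ y → u ≠ v → arcKind u v ≠ .coCorner := by
  decide

/-- Side bookkeeping: for `{x, y} = {N, W}` or `{S, E}`, an arc through `x` avoiding `y` is not a corner arc.
[cite: GlazmanManolescu2019, §1, Fig. 1] -/
private theorem arcKind_ne_corner_of_adj : ∀ x y u v : Side,
    ((x = .N ∧ y = .W) ∨ (x = .W ∧ y = .N) ∨ (x = .S ∧ y = .E) ∨ (x = .E ∧ y = .S)) →
      (u = x ∨ v = x) → u ≠ y → v ≠ y → u ≠ v → arcKind u v ≠ .corner := by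
  decide

/-- ★★★★★ **THE MARKING LAW (two arcs).** Hole absent; a lattice cut from the lower corner of the root edge to beyond the domain,
edges neither the hole's `W` side nor the root edge, all dead except the `i`-th and the `k`-th (`i < k`), which are two
different sides `g.side x`, `g.side y` of ONE rhombus `g` other than the far cell. Then every class-`B2a` UNDER-walk at the far
cell whose excursion polygon winds around the root carries TWO ARCS in `g`: a prefix arc `m ≤ F − 1` with the end `x` and
without the end `y`, and an excursion arc `m' ≥ F + 1` with the end `y` and without the end `x`; the kind list of `g` is
`[corner, corner]` or `[coCorner, coCorner]`, both arcs of that kind.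
[cite: GlazmanManolescu2019, §1, Fig. 1 (two arcs in a rhombus: the configurations w₁, w₂)]
[cite: Glazman2015WeightedSAW, Lemma 3.1 (proof, pp. 6–7)] [cite: CourantRobbins1958, Ch. V Appendix §2 (the even–odd rule)] -/
theorem exists_two_arcs_of_twoLive_cut (hh : holeFaceW w ∉ D) (hr : RootedFace D (w.side .W) (farW w)) (h : ω.IsB2a)
    (hS : ω.2.firstSideG = .S) {q : ℕ → ℤ × ℤ} {c : ℕ → Face} {s : ℕ → Side} {K : ℕ} (hq0 : q 0 = w)
    (hseg : ∀ k, k < K → segment ℝ (toC (cornerPt (q k))) (toC (cornerPt (q (k + 1)))) = sideSeg (c k) (s k))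
    (h1 : ∀ k, k < K → (c k).side (s k) ≠ (holeFaceW w).side .W) (h2 : ∀ k, k < K → (c k).side (s k) ≠ w.side .W)
    (hexit : (∀ f : Face, f ∈ D → f.1 < (q K).1) ∨ (∀ f : Face, f ∈ D → (q K).1 ≤ f.1) ∨
      (∀ f : Face, f ∈ D → (q K).2 ≤ f.2) ∨ (∀ f : Face, f ∈ D → f.2 < (q K).2))
    {i k : ℕ} (hik : i < k)
    (hdead : ∀ k', k' < K → k' ≠ i → k' ≠ k →
      ((c k').side (s k')).faces.1 ∉ D ∨ ((c k').side (s k')).faces.2 ∉ D)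
    {g : Face} (hg : g ≠ farW w) {x y : Side} (hci : (c i).side (s i) = g.side x) (hck : (c k).side (s k) = g.side y)
    (hA : ω.AJ hr h (toC (midPt (w.side .W))) ≠ 0) :
    ∃ m m', m + 1 ≤ ω.2.firstHitG ∧ ω.2.firstHitG + 1 ≤ m' ∧ m' < ω.2.arcs.length ∧ ω.2.fc m = g ∧ ω.2.fc m' = g ∧
      (ω.2.sIn m = x ∨ ω.2.sOut m = x) ∧ ω.2.sIn m ≠ y ∧ ω.2.sOut m ≠ y ∧ ω.2.sIn m ≠ ω.2.sOut m ∧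
      (ω.2.sIn m' = y ∨ ω.2.sOut m' = y) ∧ ω.2.sIn m' ≠ x ∧ ω.2.sOut m' ≠ x ∧ ω.2.sIn m' ≠ ω.2.sOut m' ∧
      ((ω.2.kindsIn g = [.corner, .corner] ∧ arcKind (ω.2.sIn m) (ω.2.sOut m) = .corner ∧
          arcKind (ω.2.sIn m') (ω.2.sOut m') = .corner) ∨
        (ω.2.kindsIn g = [.coCorner, .coCorner] ∧ arcKind (ω.2.sIn m) (ω.2.sOut m) = .coCorner ∧
          arcKind (ω.2.sIn m') (ω.2.sOut m') = .coCorner)) := by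
  have hF := ω.fh_lt h
  have hlen : ω.2.arcs.length = ω.2.firstHitG + ω.Mv := len_eq h
  obtain ⟨⟨i', hi1, hiF, e⟩, j, hj, e'⟩ :=
    prefix_and_exit_of_twoLive_cut hh hr h hS hq0 hseg h1 h2 hexit hik hdead hA
  rw [hci] at e
  rw [hck] at e'
  obtain ⟨m, hmF, hfm, hx⟩ := exists_prefix_arc_of_nth_eq hr h hi1 hiF hg e
  obtain ⟨m', hm'F, hm'n, hfm', hy⟩ := exists_excursion_arc_of_exit_eq hr h hj hg e'
  -- the ends of the two arcs are four distinct mid-edges of the walk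
  obtain ⟨hin, hout, hio⟩ := ω.2.side_sIn_nth (i := m) (by omega)
  obtain ⟨hin', hout', hio'⟩ := ω.2.side_sIn_nth (i := m') hm'n
  rw [hfm] at hin hout
  rw [hfm'] at hin' hout'
  have ey : g.side y = ω.2.nth (ω.2.firstHitG + j + 1) := by rw [← e', side_jOut (hr := hr) h hj]
  have hmy1 : ω.2.sIn m ≠ y := by
    intro hc; rw [hc, ey] at hin
    have := ω.2.nth_inj (by omega) (by omega) hin; omega
  have hmy2 : ω.2.sOut m ≠ y := by
    intro hc; rw [hc, ey] at hout
    have := ω.2.nth_inj (by omega) (by omega) hout; omega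
  have hmx1 : ω.2.sIn m' ≠ x := by
    intro hc; rw [hc, ← e] at hin'
    have := ω.2.nth_inj (by omega) (by omega) hin'; omega
  have hmx2 : ω.2.sOut m' ≠ x := by
    intro hc; rw [hc, ← e] at hout'
    have := ω.2.nth_inj (by omega) (by omega) hout'; omega
  refine ⟨m, m', hmF, hm'F, hm'n, hfm, hfm', hx, hmy1, hmy2, hio, hy, hmx1, hmx2, hio', ?_⟩
  have k1 := ω.2.arcKind_eq_of_two_arcs (m := m) (m' := m') (by omega) hm'n (by omega) (hfm'.trans hfm.symm)
    (n := m) (by omega) rfl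
  have k2 := ω.2.arcKind_eq_of_two_arcs (m := m) (m' := m') (by omega) hm'n (by omega) (hfm'.trans hfm.symm)
    (n := m') hm'n (hfm'.trans hfm.symm)
  rw [hfm] at k1 k2
  rcases k1 with ⟨e1, a1⟩ | ⟨e1, a1⟩ <;> rcases k2 with ⟨e2, a2⟩ | ⟨e2, a2⟩
  · exact Or.inl ⟨e1, a1, a2⟩
  · rw [e1] at e2; exact absurd e2 (by decide)
  · rw [e1] at e2; exact absurd e2 (by decide)
  · exact Or.inr ⟨e1, a1, a2⟩

/-- ★★★★★ **THE MARKING LAW, `θ`-corners**: if the two live edges of the cut are the sides `x`, `y` of the rhombus `g` with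
`{x, y} = {N, E}` or `{S, W}` (they meet at a `(π − θ)`-corner), every wound class-`B2a` under-walk at the far cell DOUBLES `g`
THROUGH ITS TWO `θ`-CORNERS: `kindsIn g = [corner, corner]` (the local weight `w₁`, vanishing at `θ = 2π/3`).
[cite: GlazmanManolescu2019, §1, Fig. 1 (two arcs at the two θ-corners weigh w₁), remark after eq. (1)]
[cite: Glazman2015WeightedSAW, Lemma 3.1 (proof, pp. 6–7)] [cite: CourantRobbins1958, Ch. V Appendix §2 (the even–odd rule)] -/
theorem kindsIn_eq_corner_corner_of_twoLive_cut (hh : holeFaceW w ∉ D) (hr : RootedFace D (w.side .W) (farW w))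
    (h : ω.IsB2a) (hS : ω.2.firstSideG = .S) {q : ℕ → ℤ × ℤ} {c : ℕ → Face} {s : ℕ → Side} {K : ℕ} (hq0 : q 0 = w)
    (hseg : ∀ k, k < K → segment ℝ (toC (cornerPt (q k))) (toC (cornerPt (q (k + 1)))) = sideSeg (c k) (s k))
    (h1 : ∀ k, k < K → (c k).side (s k) ≠ (holeFaceW w).side .W) (h2 : ∀ k, k < K → (c k).side (s k) ≠ w.side .W)
    (hexit : (∀ f : Face, f ∈ D → f.1 < (q K).1) ∨ (∀ f : Face, f ∈ D → (q K).1 ≤ f.1) ∨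
      (∀ f : Face, f ∈ D → (q K).2 ≤ f.2) ∨ (∀ f : Face, f ∈ D → f.2 < (q K).2))
    {i k : ℕ} (hik : i < k)
    (hdead : ∀ k', k' < K → k' ≠ i → k' ≠ k →
      ((c k').side (s k')).faces.1 ∉ D ∨ ((c k').side (s k')).faces.2 ∉ D)
    {g : Face} (hg : g ≠ farW w) {x y : Side}
    (hxy : (x = .N ∧ y = .E) ∨ (x = .E ∧ y = .N) ∨ (x = .S ∧ y = .W) ∨ (x = .W ∧ y = .S))
    (hci : (c i).side (s i) = g.side x) (hck : (c k).side (s k) = g.side y)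
    (hA : ω.AJ hr h (toC (midPt (w.side .W))) ≠ 0) : ω.2.kindsIn g = [.corner, .corner] := by
  obtain ⟨m, m', -, -, -, -, -, hx, hy1, hy2, hio, -, -, -, -, hk⟩ :=
    exists_two_arcs_of_twoLive_cut hh hr h hS hq0 hseg h1 h2 hexit hik hdead hg hci hck hA
  rcases hk with ⟨e1, -, -⟩ | ⟨-, a1, -⟩
  · exact e1
  · exact absurd a1 (arcKind_ne_coCorner_of_adj x y _ _ hxy hx hy1 hy2 hio)

/-- ★★★★★ **THE MARKING LAW, `(π − θ)`-corners**: if `{x, y} = {N, W}` or `{S, E}` (the two live sides meet at a `θ`-corner),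
every wound under-walk doubles `g` through its two `(π − θ)`-corners: `kindsIn g = [coCorner, coCorner]` (the local weight `w₂`,
vanishing at `θ = π/3`). [cite: GlazmanManolescu2019, §1, Fig. 1 (two arcs at the two (π−θ)-corners weigh w₂), Fig. 2]
[cite: Glazman2015WeightedSAW, Lemma 3.1 (proof, pp. 6–7)] [cite: CourantRobbins1958, Ch. V Appendix §2 (the even–odd rule)] -/
theorem kindsIn_eq_coCorner_coCorner_of_twoLive_cut (hh : holeFaceW w ∉ D) (hr : RootedFace D (w.side .W) (farW w))
    (h : ω.IsB2a) (hS : ω.2.firstSideG = .S) {q : ℕ → ℤ × ℤ} {c : ℕ → Face} {s : ℕ → Side} {K : ℕ} (hq0 : q 0 = w)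
    (hseg : ∀ k, k < K → segment ℝ (toC (cornerPt (q k))) (toC (cornerPt (q (k + 1)))) = sideSeg (c k) (s k))
    (h1 : ∀ k, k < K → (c k).side (s k) ≠ (holeFaceW w).side .W) (h2 : ∀ k, k < K → (c k).side (s k) ≠ w.side .W)
    (hexit : (∀ f : Face, f ∈ D → f.1 < (q K).1) ∨ (∀ f : Face, f ∈ D → (q K).1 ≤ f.1) ∨
      (∀ f : Face, f ∈ D → (q K).2 ≤ f.2) ∨ (∀ f : Face, f ∈ D → f.2 < (q K).2))
    {i k : ℕ} (hik : i < k)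
    (hdead : ∀ k', k' < K → k' ≠ i → k' ≠ k →
      ((c k').side (s k')).faces.1 ∉ D ∨ ((c k').side (s k')).faces.2 ∉ D)
    {g : Face} (hg : g ≠ farW w) {x y : Side}
    (hxy : (x = .N ∧ y = .W) ∨ (x = .W ∧ y = .N) ∨ (x = .S ∧ y = .E) ∨ (x = .E ∧ y = .S))
    (hci : (c i).side (s i) = g.side x) (hck : (c k).side (s k) = g.side y)
    (hA : ω.AJ hr h (toC (midPt (w.side .W))) ≠ 0) : ω.2.kindsIn g = [.coCorner, .coCorner] := by
  obtain ⟨m, m', -, -, -, -, -, hx, hy1, hy2, hio, -, -, -, -, hk⟩ :=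
    exists_two_arcs_of_twoLive_cut hh hr h hS hq0 hseg h1 h2 hexit hik hdead hg hci hck hA
  rcases hk with ⟨-, a1, -⟩ | ⟨e1, -, -⟩
  · exact absurd a1 (arcKind_ne_corner_of_adj x y _ _ hxy hx hy1 hy2 hio)
  · exact e1

/-- A rhombus with a non-empty kind list is visited. [cite: GlazmanManolescu2019, §1, Fig. 1] -/
private theorem mem_facesVisited_of_kindsIn_ne_nil {g : Face} (hk : ω.2.kindsIn g ≠ []) : g ∈ ω.2.facesVisited := by
  by_contra hn
  exact hk (YBWalk.kindsIn_eq_nil hn)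

/-! ## §4 LAW L's two under-route kills as instances: the corner cells below the kill row -/

/-- The reversed companion of a wound walk has the same kinds off the far cell: a `[k, k]` list transports.
[cite: GlazmanManolescu2019, §2.1 (walks and their reversals)] -/
private theorem kindsIn_eq_pair_of_rev (hr : RootedFace D (w.side .W) (farW w)) (h : ω.IsB2a) {g : Face}
    (hg : g ≠ farW w) {κ : ArcKind} (hk : (ω.rev hr).2.kindsIn g = [κ, κ]) : ω.2.kindsIn g = [κ, κ] := by
  have hperm := ω.kindsIn_rev_perm hr h hg
  rw [hk] at hperm
  have hp : (ω.2.kindsIn g).Perm (List.replicate 2 κ) := hperm.symm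
  exact List.perm_replicate.1 hp

/-- ★★★★★ **`K_S1` WITH THE COLUMN BELOW IT SHUT ⇒ EVERY WOUND UNDER-WALK DOUBLES `rootS` THROUGH ITS TWO `θ`-CORNERS.** Hole and
`killSE w = (w.1 + 1, w.2 − 2)` absent; for some floor row `Y ≤ w.2 − 2`, no face of `D` lies below row `Y` and every west side of
column `w.1 + 1` in the rows `Y, …, w.2 − 3` is dead (`(w.1, y) ∉ D ∨ (w.1 + 1, y) ∉ D`). The cut `[w.S, pocketSE.W, killSE.W, …]`
down to the floor has exactly the two live edges `rootS.N` and `rootS.E`: by the marking law, `kindsIn (rootS w) = [corner,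
corner]` for every class-`B2a` under-walk whose excursion polygon winds around the root.
[cite: GlazmanManolescu2019, §1, Fig. 1 (two arcs at the two θ-corners weigh w₁), remark after eq. (1)]
[cite: Glazman2015WeightedSAW, Lemma 3.1 (proof, pp. 6–7)] [cite: CourantRobbins1958, Ch. V Appendix §2 (the even–odd rule)] -/
theorem kindsIn_rootS_eq_of_AJ_ne_zero_under_killSE_column (hh : holeFaceW w ∉ D) (hK : killSE w ∉ D) {Y : ℤ}
    (hY : Y ≤ w.2 - 2) (hcol : ∀ y : ℤ, Y ≤ y → y ≤ w.2 - 3 → ((w.1, y) : Face) ∉ D ∨ ((w.1 + 1, y) : Face) ∉ D)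
    (hfloor : ∀ f : Face, f ∈ D → Y ≤ f.2)
    (ω : ΩG D (w.side .W) (farW w)) (hr : RootedFace D (w.side .W) (farW w)) (h : ω.IsB2a)
    (hS : ω.2.firstSideG = .S) (hA : ω.AJ hr h (toC (midPt (w.side .W))) ≠ 0) :
    ω.2.kindsIn (rootS w) = [.corner, .corner] := by
  set K : ℕ := (w.2 - Y).toNat + 1 with hKdef
  have hK1 : ((K - 1 : ℕ) : ℤ) = w.2 - Y := by rw [hKdef]; omega
  refine kindsIn_eq_corner_corner_of_twoLive_cut hh hr h hS
    (q := fun k => (w.1 + min (k : ℤ) 1, w.2 - ((k - 1 : ℕ) : ℤ)))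
    (c := fun k => if k = 0 then w else (w.1 + 1, w.2 - k)) (s := fun k => if k = 0 then Side.S else Side.W) (K := K)
    (by simp) (fun k hk => ?_) (fun k hk => ?_) (fun k hk => ?_) (Or.inr (Or.inr (Or.inl fun f hf => ?_)))
    (i := 0) (k := 1) zero_lt_one (fun k' hk' h0 h1' => ?_) (g := rootS w) (rootS_ne_farW w) (x := .N) (y := .E)
    (Or.inl ⟨rfl, rfl⟩) ?_ ?_ hA
  · -- the steps of the cut
    rcases Nat.eq_zero_or_pos k with rfl | hk1
    · simpa using segment_cornerPt_east ((w.1, w.2) : ℤ × ℤ)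
    · have e1 : ((k - 1 : ℕ) : ℤ) = k - 1 := by omega
      have e2 : ((k + 1 - 1 : ℕ) : ℤ) = k := by omega
      simp only [Nat.cast_add, Nat.cast_one, e1, e2, if_neg (show k ≠ 0 by omega),
        min_eq_right (show (1 : ℤ) ≤ k by exact_mod_cast hk1), min_eq_right (show (1 : ℤ) ≤ k + 1 by omega)]
      have := segment_cornerPt_south ((w.1 + 1, w.2 - (k - 1 : ℤ)) : ℤ × ℤ)
      simp only at this
      rw [show w.2 - ((k : ℤ) - 1) - 1 = w.2 - k by ring] at this
      exact this
  · rcases Nat.eq_zero_or_pos k with rfl | hk1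
    · obtain ⟨a, b⟩ := w; simp [holeFaceW, Face.side]
    · rw [if_neg (show k ≠ 0 by omega), if_neg (show k ≠ 0 by omega)]
      obtain ⟨a, b⟩ := w
      simp only [holeFaceW, Face.side, ne_eq, MidEdge.vert.injEq, not_and]
      intro h; omega
  · rcases Nat.eq_zero_or_pos k with rfl | hk1
    · obtain ⟨a, b⟩ := w; simp [Face.side]
    · rw [if_neg (show k ≠ 0 by omega), if_neg (show k ≠ 0 by omega)]
      obtain ⟨a, b⟩ := w
      simp only [Face.side, ne_eq, MidEdge.vert.injEq, not_and]
      intro h; omega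
  · have := hfloor f hf; simp only [hK1]; omega
  · -- the dead edges: `killSE.W` and the shut column below it
    have hk2 : 2 ≤ k' := by omega
    simp only [if_neg (show k' ≠ 0 by omega)]
    rcases eq_or_lt_of_le hk2 with e2 | h3
    · subst e2
      right
      have e : killSE w = (w.1 + 1, w.2 - ((2 : ℕ) : ℤ)) := by obtain ⟨a, b⟩ := w; simp [killSE]
      simpa [Face.side, MidEdge.faces, e] using hK
    · have hk'K : (k' : ℤ) ≤ w.2 - Y := by omega
      rcases hcol (w.2 - k') (by omega) (by omega) with hd | hd
      · left
        have e : ((w.1, w.2 - k') : Face) = (w.1 + 1 - 1, w.2 - k') := Prod.ext (by simp) rfl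
        simpa [Face.side, MidEdge.faces, e] using hd
      · right; simpa [Face.side, MidEdge.faces] using hd
  · norm_num; exact root_side_S_eq_rootS_side_N w
  · norm_num; obtain ⟨a, b⟩ := w; simp [rootS, Face.side]

/-- ★★★★★ **Wound form, either orientation: `K_S1` with the column below it shut ⇒ every WOUND class-`B2a` UNDER-walk at the far
cell is `w₁`-MARKED off the far cell** (its Yang–Baxter weight vanishes at `θ = 2π/3`).
[cite: GlazmanManolescu2019, §1, Fig. 1 and the remark after eq. (1) («w₁ = 0 at θ = 2π/3»)]
[cite: Glazman2015WeightedSAW, Lemma 3.1 (proof, pp. 6–7)] [cite: CourantRobbins1958, Ch. V Appendix §2 (the even–odd rule)] -/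
theorem not_W1FreeOff_farW_of_wound_under_killSE_column (hh : holeFaceW w ∉ D) (hK : killSE w ∉ D) {Y : ℤ}
    (hY : Y ≤ w.2 - 2) (hcol : ∀ y : ℤ, Y ≤ y → y ≤ w.2 - 3 → ((w.1, y) : Face) ∉ D ∨ ((w.1 + 1, y) : Face) ∉ D)
    (hfloor : ∀ f : Face, f ∈ D → Y ≤ f.2)
    (ω : ΩG D (w.side .W) (farW w)) (hr : RootedFace D (w.side .W) (farW w)) (h : ω.IsB2a)
    (hS : ω.2.firstSideG = .S) {θ : ℝ}
    (hW : ω.WE (fun _ => θ) ≠ excursionWinding θ ω.2.firstSideG (ω.z1 hr h) ω.1) : ¬ω.2.W1FreeOff (farW w) := by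
  have key : ω.2.kindsIn (rootS w) = [.corner, .corner] := by
    rcases ω.AJ_ne_zero_or_rev_of_wound hr h θ hW with hA | hA
    · exact kindsIn_rootS_eq_of_AJ_ne_zero_under_killSE_column hh hK hY hcol hfloor ω hr h hS hA
    · have h' := ω.rev_isB2a hr h
      have hS' : (ω.rev hr).2.firstSideG = .S := by rw [ω.rev_firstSide hr h]; exact hS
      exact kindsIn_eq_pair_of_rev hr h (rootS_ne_farW w)
        (kindsIn_rootS_eq_of_AJ_ne_zero_under_killSE_column hh hK hY hcol hfloor (ω.rev hr) hr h' hS' hA)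
  intro hfree
  exact hfree _ (mem_facesVisited_of_kindsIn_ne_nil (by rw [key]; exact List.cons_ne_nil _ _)) (rootS_ne_farW w) key

/-- ★★★★★ **`K_S2` WITH THE COLUMN BELOW IT SHUT ⇒ EVERY WOUND UNDER-WALK DOUBLES `farSW` THROUGH ITS TWO `(π − θ)`-CORNERS.**
Hole and `killSW w = (w.1 − 3, w.2 − 2)` absent; for some floor row `Y ≤ w.2 − 2`, no face of `D` below row `Y` and every west
side of the far cell's column `w.1 − 2` in the rows `Y, …, w.2 − 3` dead (`(w.1 − 3, y) ∉ D ∨ (w.1 − 2, y) ∉ D`). The cut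
`[hole.S, holeS.W, farSW.S, killSW.E, …]` down to the floor has exactly the two live edges `farSW.E` and `farSW.S`: by the marking
law, `kindsIn (farSW w) = [coCorner, coCorner]` for every class-`B2a` under-walk whose excursion polygon winds around the root.
[cite: GlazmanManolescu2019, §1, Fig. 1 (two arcs at the two (π−θ)-corners weigh w₂), Fig. 2 («if θ = π/3, then w₂ = 0»)]
[cite: Glazman2015WeightedSAW, Lemma 3.1 (proof, pp. 6–7)] [cite: CourantRobbins1958, Ch. V Appendix §2 (the even–odd rule)] -/
theorem kindsIn_farSW_eq_of_AJ_ne_zero_under_killSW_column (hh : holeFaceW w ∉ D) (hK : killSW w ∉ D) {Y : ℤ}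
    (hY : Y ≤ w.2 - 2) (hcol : ∀ y : ℤ, Y ≤ y → y ≤ w.2 - 3 → ((w.1 - 3, y) : Face) ∉ D ∨ ((w.1 - 2, y) : Face) ∉ D)
    (hfloor : ∀ f : Face, f ∈ D → Y ≤ f.2)
    (ω : ΩG D (w.side .W) (farW w)) (hr : RootedFace D (w.side .W) (farW w)) (h : ω.IsB2a)
    (hS : ω.2.firstSideG = .S) (hA : ω.AJ hr h (toC (midPt (w.side .W))) ≠ 0) :
    ω.2.kindsIn (farSW w) = [.coCorner, .coCorner] := by
  set K : ℕ := (w.2 + 2 - Y).toNat with hKdef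
  have hK4 : 4 ≤ K := by rw [hKdef]; omega
  have hKZ : (K : ℤ) = w.2 + 2 - Y := by rw [hKdef]; omega
  refine kindsIn_eq_coCorner_coCorner_of_twoLive_cut hh hr h hS
    (q := fun k => if k = 0 then (w.1, w.2) else if k = 1 then (w.1 - 1, w.2) else if k = 2 then (w.1 - 1, w.2 - 1)
      else (w.1 - 2, w.2 + 2 - k))
    (c := fun k => if k = 0 then (w.1 - 1, w.2) else if k = 1 then (w.1 - 1, w.2 - 1) else if k = 2 then (w.1 - 2, w.2 - 1)
      else (w.1 - 2, w.2 + 1 - k))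
    (s := fun k => if k = 0 ∨ k = 2 then Side.S else Side.W) (K := K)
    (by simp) (fun k hk => ?_) (fun k hk => ?_) (fun k hk => ?_) (Or.inr (Or.inr (Or.inl fun f hf => ?_)))
    (i := 1) (k := 2) one_lt_two (fun k' hk' h0 h1' => ?_) (g := farSW w) (farSW_ne_farW w) (x := .E) (y := .S)
    (Or.inr (Or.inr (Or.inr ⟨rfl, rfl⟩))) ?_ ?_ hA
  · -- the steps of the cut
    rcases (by omega : k = 0 ∨ k = 1 ∨ k = 2 ∨ 3 ≤ k) with rfl | rfl | rfl | hk3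
    · simpa using segment_cornerPt_west ((w.1, w.2) : ℤ × ℤ)
    · simpa using segment_cornerPt_south ((w.1 - 1, w.2) : ℤ × ℤ)
    · have := segment_cornerPt_west ((w.1 - 1, w.2 - 1) : ℤ × ℤ)
      norm_num at this ⊢
      rw [show w.1 - 1 - 1 = w.1 - 2 by ring] at this
      rw [show w.2 + 2 - 3 = w.2 - 1 by ring]
      exact this
    · simp only [if_neg (show k ≠ 0 by omega), if_neg (show k ≠ 1 by omega), if_neg (show k ≠ 2 by omega),
        if_neg (show k + 1 ≠ 0 by omega), if_neg (show k + 1 ≠ 1 by omega), if_neg (show k + 1 ≠ 2 by omega),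
        show ¬(k = 0 ∨ k = 2) by omega, Nat.cast_add, Nat.cast_one]
      have := segment_cornerPt_south ((w.1 - 2, w.2 + 2 - k) : ℤ × ℤ)
      simp only at this
      rw [show w.2 + 2 - (k : ℤ) - 1 = w.2 + 1 - k by ring] at this
      rw [show w.2 + 2 - ((k : ℤ) + 1) = w.2 + 1 - k by ring]
      exact this
  · rcases (by omega : k = 0 ∨ k = 1 ∨ k = 2 ∨ 3 ≤ k) with rfl | rfl | rfl | hk3
    · obtain ⟨a, b⟩ := w; simp [holeFaceW, Face.side]
    · obtain ⟨a, b⟩ := w; simp [holeFaceW, Face.side]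
    · obtain ⟨a, b⟩ := w; simp [holeFaceW, Face.side]
    · simp only [if_neg (show k ≠ 0 by omega), if_neg (show k ≠ 1 by omega), if_neg (show k ≠ 2 by omega),
        show ¬(k = 0 ∨ k = 2) by omega, if_false]
      obtain ⟨a, b⟩ := w; simp [holeFaceW, Face.side]
  · rcases (by omega : k = 0 ∨ k = 1 ∨ k = 2 ∨ 3 ≤ k) with rfl | rfl | rfl | hk3
    · obtain ⟨a, b⟩ := w; simp [Face.side]
    · obtain ⟨a, b⟩ := w; simp [Face.side]
    · obtain ⟨a, b⟩ := w; simp [Face.side]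
    · simp only [if_neg (show k ≠ 0 by omega), if_neg (show k ≠ 1 by omega), if_neg (show k ≠ 2 by omega),
        show ¬(k = 0 ∨ k = 2) by omega, if_false]
      obtain ⟨a, b⟩ := w; simp [Face.side]
  · have := hfloor f hf
    simp only [if_neg (show K ≠ 0 by omega), if_neg (show K ≠ 1 by omega), if_neg (show K ≠ 2 by omega), hKZ]
    omega
  · -- the dead edges: the hole's bottom, `killSW.E`, the shut column below it
    rcases (by omega : k' = 0 ∨ k' = 3 ∨ 4 ≤ k') with rfl | rfl | hk4
    · right
      have e : holeFaceW w = (w.1 - 1, w.2) := by obtain ⟨a, b⟩ := w; simp [holeFaceW]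
      simpa [Face.side, MidEdge.faces, e] using hh
    · left
      have e : killSW w = (w.1 - 2 - 1, w.2 + 1 - ((3 : ℕ) : ℤ)) := Prod.ext (by simp [killSW]; ring) (by simp [killSW]; ring)
      norm_num [Face.side, MidEdge.faces]
      rw [e] at hK; norm_num at hK; exact hK
    · simp only [if_neg (show k' ≠ 0 by omega), if_neg (show k' ≠ 1 by omega), if_neg (show k' ≠ 2 by omega),
        show ¬(k' = 0 ∨ k' = 2) by omega, if_false]
      have hk'K : (k' : ℤ) ≤ w.2 + 1 - Y := by omega
      rcases hcol (w.2 + 1 - k') (by omega) (by omega) with hd | hd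
      · left
        have e : ((w.1 - 3, w.2 + 1 - k') : Face) = (w.1 - 2 - 1, w.2 + 1 - k') := Prod.ext (by simp only; ring) rfl
        simpa [Face.side, MidEdge.faces, e] using hd
      · right; simpa [Face.side, MidEdge.faces] using hd
  · norm_num; obtain ⟨a, b⟩ := w; simp [farSW, Face.side]; ring
  · norm_num; obtain ⟨a, b⟩ := w; simp [farSW, Face.side]

/-- ★★★★★ **Wound form, either orientation: `K_S2` with the column below it shut ⇒ every WOUND class-`B2a` UNDER-walk at the far
cell is `w₂`-MARKED off the far cell** (its Yang–Baxter weight vanishes at `θ = π/3`).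
[cite: GlazmanManolescu2019, §1, Fig. 2 («if θ = π/3, then w₂ = 0»)]
[cite: Glazman2015WeightedSAW, Lemma 3.1 (proof, pp. 6–7)] [cite: CourantRobbins1958, Ch. V Appendix §2 (the even–odd rule)] -/
theorem not_W2FreeOff_farW_of_wound_under_killSW_column (hh : holeFaceW w ∉ D) (hK : killSW w ∉ D) {Y : ℤ}
    (hY : Y ≤ w.2 - 2) (hcol : ∀ y : ℤ, Y ≤ y → y ≤ w.2 - 3 → ((w.1 - 3, y) : Face) ∉ D ∨ ((w.1 - 2, y) : Face) ∉ D)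
    (hfloor : ∀ f : Face, f ∈ D → Y ≤ f.2)
    (ω : ΩG D (w.side .W) (farW w)) (hr : RootedFace D (w.side .W) (farW w)) (h : ω.IsB2a)
    (hS : ω.2.firstSideG = .S) {θ : ℝ}
    (hW : ω.WE (fun _ => θ) ≠ excursionWinding θ ω.2.firstSideG (ω.z1 hr h) ω.1) : ¬ω.2.W2FreeOff (farW w) := by
  have key : ω.2.kindsIn (farSW w) = [.coCorner, .coCorner] := by
    rcases ω.AJ_ne_zero_or_rev_of_wound hr h θ hW with hA | hA
    · exact kindsIn_farSW_eq_of_AJ_ne_zero_under_killSW_column hh hK hY hcol hfloor ω hr h hS hA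
    · have h' := ω.rev_isB2a hr h
      have hS' : (ω.rev hr).2.firstSideG = .S := by rw [ω.rev_firstSide hr h]; exact hS
      exact kindsIn_eq_pair_of_rev hr h (farSW_ne_farW w)
        (kindsIn_farSW_eq_of_AJ_ne_zero_under_killSW_column hh hK hY hcol hfloor (ω.rev hr) hr h' hS' hA)
  intro hfree
  exact hfree _ (mem_facesVisited_of_kindsIn_ne_nil (by rw [key]; exact List.cons_ne_nil _ _)) (farSW_ne_farW w) key

/-- ★★★★★ **`K_S1` ON THE EAST WALL ⇒ EVERY WOUND UNDER-WALK DOUBLES `rootS` THROUGH ITS TWO `θ`-CORNERS.** Hole and `killSE w`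
absent and no face of `D` in the columns `≥ w.1 + 2`. The cut `[w.S, pocketSE.W, killSE.W, killSE.S]` out through the east wall has
exactly the two live edges `rootS.N`, `rootS.E`. [cite: GlazmanManolescu2019, §1, Fig. 1 (two arcs at the two θ-corners weigh w₁), remark after eq. (1)]
[cite: Glazman2015WeightedSAW, Lemma 3.1 (proof, pp. 6–7)] [cite: CourantRobbins1958, Ch. V Appendix §2 (the even–odd rule)] -/
theorem kindsIn_rootS_eq_of_AJ_ne_zero_under_killSE_eastWall (hh : holeFaceW w ∉ D) (hK : killSE w ∉ D)
    (heast : ∀ f : Face, f ∈ D → f.1 < w.1 + 2)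
    (ω : ΩG D (w.side .W) (farW w)) (hr : RootedFace D (w.side .W) (farW w)) (h : ω.IsB2a)
    (hS : ω.2.firstSideG = .S) (hA : ω.AJ hr h (toC (midPt (w.side .W))) ≠ 0) :
    ω.2.kindsIn (rootS w) = [.corner, .corner] := by
  refine kindsIn_eq_corner_corner_of_twoLive_cut hh hr h hS
    (q := fun k => if k = 0 then (w.1, w.2) else if k = 1 then (w.1 + 1, w.2) else if k = 2 then (w.1 + 1, w.2 - 1)
      else if k = 3 then (w.1 + 1, w.2 - 2) else (w.1 + 2, w.2 - 2))
    (c := fun k => if k = 0 then w else if k = 1 then (w.1 + 1, w.2 - 1) else (w.1 + 1, w.2 - 2))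
    (s := fun k => if k = 0 ∨ k = 3 then Side.S else Side.W) (K := 4)
    (by simp) (fun k hk => ?_) (fun k hk => ?_) (fun k hk => ?_) (Or.inl fun f hf => ?_)
    (i := 0) (k := 1) zero_lt_one (fun k' hk' h0 h1' => ?_) (g := rootS w) (rootS_ne_farW w) (x := .N) (y := .E)
    (Or.inl ⟨rfl, rfl⟩) ?_ ?_ hA
  · interval_cases k
    · simpa using segment_cornerPt_east ((w.1, w.2) : ℤ × ℤ)
    · simpa using segment_cornerPt_south ((w.1 + 1, w.2) : ℤ × ℤ)
    · have := segment_cornerPt_south ((w.1 + 1, w.2 - 1) : ℤ × ℤ)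
      norm_num at this ⊢
      rw [show w.2 - 1 - 1 = w.2 - 2 by ring] at this
      exact this
    · have := segment_cornerPt_east ((w.1 + 1, w.2 - 2) : ℤ × ℤ)
      norm_num at this ⊢
      rw [show w.1 + 1 + 1 = w.1 + 2 by ring] at this
      exact this
  · interval_cases k <;> (obtain ⟨a, b⟩ := w; simp [holeFaceW, Face.side])
  · interval_cases k <;> (obtain ⟨a, b⟩ := w; simp [Face.side])
  · have := heast f hf; norm_num; omega
  · have hk2 : k' = 2 ∨ k' = 3 := by omega
    rcases hk2 with rfl | rfl
    · right
      have e : killSE w = (w.1 + 1, w.2 - 2) := by obtain ⟨a, b⟩ := w; simp [killSE]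
      norm_num [Face.side, MidEdge.faces]; rw [e] at hK; exact hK
    · right
      have e : killSE w = (w.1 + 1, w.2 - 2) := by obtain ⟨a, b⟩ := w; simp [killSE]
      norm_num [Face.side, MidEdge.faces]
      rw [e] at hK; exact hK
  · norm_num; exact root_side_S_eq_rootS_side_N w
  · norm_num; obtain ⟨a, b⟩ := w; simp [rootS, Face.side]

/-- ★★★★★ **`K_S2` ON THE WEST WALL ⇒ EVERY WOUND UNDER-WALK DOUBLES `farSW` THROUGH ITS TWO `(π − θ)`-CORNERS.** Hole and
`killSW w = (w.1 − 3, w.2 − 2)` absent and no face of `D` in the columns `< w.1 − 3`. The cut `[hole.S, holeS.W, farSW.S, killSW.E,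
killSW.S]` out through the west wall has exactly the two live edges `farSW.E`, `farSW.S`.
[cite: GlazmanManolescu2019, §1, Fig. 1 (two arcs at the two (π−θ)-corners weigh w₂), Fig. 2]
[cite: Glazman2015WeightedSAW, Lemma 3.1 (proof, pp. 6–7)] [cite: CourantRobbins1958, Ch. V Appendix §2 (the even–odd rule)] -/
theorem kindsIn_farSW_eq_of_AJ_ne_zero_under_killSW_westWall (hh : holeFaceW w ∉ D) (hK : killSW w ∉ D)
    (hwest : ∀ f : Face, f ∈ D → w.1 - 3 ≤ f.1)
    (ω : ΩG D (w.side .W) (farW w)) (hr : RootedFace D (w.side .W) (farW w)) (h : ω.IsB2a)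
    (hS : ω.2.firstSideG = .S) (hA : ω.AJ hr h (toC (midPt (w.side .W))) ≠ 0) :
    ω.2.kindsIn (farSW w) = [.coCorner, .coCorner] := by
  refine kindsIn_eq_coCorner_coCorner_of_twoLive_cut hh hr h hS
    (q := fun k => if k = 0 then (w.1, w.2) else if k = 1 then (w.1 - 1, w.2) else if k = 2 then (w.1 - 1, w.2 - 1)
      else if k = 3 then (w.1 - 2, w.2 - 1) else if k = 4 then (w.1 - 2, w.2 - 2) else (w.1 - 3, w.2 - 2))
    (c := fun k => if k = 0 then (w.1 - 1, w.2) else if k = 1 then (w.1 - 1, w.2 - 1) else if k = 2 then (w.1 - 2, w.2 - 1)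
      else if k = 3 then (w.1 - 2, w.2 - 2) else (w.1 - 3, w.2 - 2))
    (s := fun k => if k = 1 ∨ k = 3 then Side.W else Side.S) (K := 5)
    (by simp) (fun k hk => ?_) (fun k hk => ?_) (fun k hk => ?_) (Or.inr (Or.inl fun f hf => ?_))
    (i := 1) (k := 2) one_lt_two (fun k' hk' h0 h1' => ?_) (g := farSW w) (farSW_ne_farW w) (x := .E) (y := .S)
    (Or.inr (Or.inr (Or.inr ⟨rfl, rfl⟩))) ?_ ?_ hA
  · interval_cases k
    · simpa using segment_cornerPt_west ((w.1, w.2) : ℤ × ℤ)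
    · simpa using segment_cornerPt_south ((w.1 - 1, w.2) : ℤ × ℤ)
    · have := segment_cornerPt_west ((w.1 - 1, w.2 - 1) : ℤ × ℤ)
      norm_num at this ⊢
      rw [show w.1 - 1 - 1 = w.1 - 2 by ring] at this
      exact this
    · have := segment_cornerPt_south ((w.1 - 2, w.2 - 1) : ℤ × ℤ)
      norm_num at this ⊢
      rw [show w.2 - 1 - 1 = w.2 - 2 by ring] at this
      exact this
    · have := segment_cornerPt_west ((w.1 - 2, w.2 - 2) : ℤ × ℤ)
      norm_num at this ⊢
      rw [show w.1 - 2 - 1 = w.1 - 3 by ring] at this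
      exact this
  · interval_cases k <;> (obtain ⟨a, b⟩ := w; simp [holeFaceW, Face.side])
  · interval_cases k <;> (obtain ⟨a, b⟩ := w; simp [Face.side]; try omega)
  · have := hwest f hf; norm_num; omega
  · have hk2 : k' = 0 ∨ k' = 3 ∨ k' = 4 := by omega
    rcases hk2 with rfl | rfl | rfl
    · right
      have e : holeFaceW w = (w.1 - 1, w.2) := by obtain ⟨a, b⟩ := w; simp [holeFaceW]
      simpa [Face.side, MidEdge.faces, e] using hh
    · left
      have e : killSW w = (w.1 - 2 - 1, w.2 - 2) := Prod.ext (by simp [killSW]; ring) (by simp [killSW])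
      norm_num [Face.side, MidEdge.faces]
      rw [e] at hK; exact hK
    · right
      have e : killSW w = (w.1 - 3, w.2 - 2) := by obtain ⟨a, b⟩ := w; simp [killSW]
      norm_num [Face.side, MidEdge.faces]
      rw [e] at hK; exact hK
  · norm_num; obtain ⟨a, b⟩ := w; simp [farSW, Face.side]; ring
  · norm_num; obtain ⟨a, b⟩ := w; simp [farSW, Face.side]

/-- ★★★★★ Wound form, either orientation: **`K_S1` on the east wall ⇒ every wound class-`B2a` under-walk is `w₁`-marked off
the far cell.** [cite: GlazmanManolescu2019, §1, Fig. 1 and the remark after eq. (1)]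
[cite: Glazman2015WeightedSAW, Lemma 3.1 (proof, pp. 6–7)] [cite: CourantRobbins1958, Ch. V Appendix §2 (the even–odd rule)] -/
theorem not_W1FreeOff_farW_of_wound_under_killSE_eastWall (hh : holeFaceW w ∉ D) (hK : killSE w ∉ D)
    (heast : ∀ f : Face, f ∈ D → f.1 < w.1 + 2)
    (ω : ΩG D (w.side .W) (farW w)) (hr : RootedFace D (w.side .W) (farW w)) (h : ω.IsB2a)
    (hS : ω.2.firstSideG = .S) {θ : ℝ}
    (hW : ω.WE (fun _ => θ) ≠ excursionWinding θ ω.2.firstSideG (ω.z1 hr h) ω.1) : ¬ω.2.W1FreeOff (farW w) := by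
  have key : ω.2.kindsIn (rootS w) = [.corner, .corner] := by
    rcases ω.AJ_ne_zero_or_rev_of_wound hr h θ hW with hA | hA
    · exact kindsIn_rootS_eq_of_AJ_ne_zero_under_killSE_eastWall hh hK heast ω hr h hS hA
    · have h' := ω.rev_isB2a hr h
      have hS' : (ω.rev hr).2.firstSideG = .S := by rw [ω.rev_firstSide hr h]; exact hS
      exact kindsIn_eq_pair_of_rev hr h (rootS_ne_farW w)
        (kindsIn_rootS_eq_of_AJ_ne_zero_under_killSE_eastWall hh hK heast (ω.rev hr) hr h' hS' hA)
  intro hfree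
  exact hfree _ (mem_facesVisited_of_kindsIn_ne_nil (by rw [key]; exact List.cons_ne_nil _ _)) (rootS_ne_farW w) key

/-- ★★★★★ Wound form, either orientation: **`K_S2` on the west wall ⇒ every wound class-`B2a` under-walk is `w₂`-marked off the
far cell.** [cite: GlazmanManolescu2019, §1, Fig. 2 («if θ = π/3, then w₂ = 0»)]
[cite: Glazman2015WeightedSAW, Lemma 3.1 (proof, pp. 6–7)] [cite: CourantRobbins1958, Ch. V Appendix §2 (the even–odd rule)] -/
theorem not_W2FreeOff_farW_of_wound_under_killSW_westWall (hh : holeFaceW w ∉ D) (hK : killSW w ∉ D)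
    (hwest : ∀ f : Face, f ∈ D → w.1 - 3 ≤ f.1)
    (ω : ΩG D (w.side .W) (farW w)) (hr : RootedFace D (w.side .W) (farW w)) (h : ω.IsB2a)
    (hS : ω.2.firstSideG = .S) {θ : ℝ}
    (hW : ω.WE (fun _ => θ) ≠ excursionWinding θ ω.2.firstSideG (ω.z1 hr h) ω.1) : ¬ω.2.W2FreeOff (farW w) := by
  have key : ω.2.kindsIn (farSW w) = [.coCorner, .coCorner] := by
    rcases ω.AJ_ne_zero_or_rev_of_wound hr h θ hW with hA | hA
    · exact kindsIn_farSW_eq_of_AJ_ne_zero_under_killSW_westWall hh hK hwest ω hr h hS hA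
    · have h' := ω.rev_isB2a hr h
      have hS' : (ω.rev hr).2.firstSideG = .S := by rw [ω.rev_firstSide hr h]; exact hS
      exact kindsIn_eq_pair_of_rev hr h (farSW_ne_farW w)
        (kindsIn_farSW_eq_of_AJ_ne_zero_under_killSW_westWall hh hK hwest (ω.rev hr) hr h' hS' hA)
  intro hfree
  exact hfree _ (mem_facesVisited_of_kindsIn_ne_nil (by rw [key]; exact List.cons_ne_nil _ _)) (farSW_ne_farW w) key

end ΩG

end Literature.Probability.RandomPlanarGeometry.SAW.YangBaxter

namespace Literature.Barriers.CriticalPhenomena.PlaquetteWalk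

open Literature.Probability.RandomPlanarGeometry.SAW.YangBaxter
open Real Complex

/-! ## §5 Boxes: the corner kill cells on a wall kill their freeness class whatever else is removed -/

section Boxes

variable {m n : ℕ} {S : List Face} {h : Face}

/-- ★★★★★ **ALL BOXES, ANY FURTHER DEFECTS: `K_S1 = (h.1 + 2, h.2 − 2)` REMOVED ON A WALL (`h.2 = 2`: bottom wall; or
`h.1 + 3 = m`: east wall) ⇒ THE UNDER ROUTE IS `w₁`-KILLED** — every wound class-`B2a` under-walk at the far cell is `w₁`-marked
off it (the lane's `lawL_box_under_w1_killed_iff` (⇐) for `S = [h, K_S1]`, now for every `S ∋ h, K_S1` missing the far cell).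
[cite: GlazmanManolescu2019, §1 (remark after eq. (1)), Lemma 2.1]
[cite: Glazman2015WeightedSAW, Lemma 3.1 (proof, pp. 6–7)] [cite: CourantRobbins1958, Ch. V Appendix §2 (the even–odd rule)] -/
theorem lawL_box_killSE_wall_under_w1_killed (hW : 1 ≤ h.1) (hE : h.1 + 3 ≤ m) (hS2 : 2 ≤ h.2) (hN : h.2 + 1 ≤ n)
    (hbdry : h.2 = 2 ∨ h.1 + 3 = m) (hh : h ∈ S) (hfS : ((h.1 - 1, h.2) : Face) ∉ S)
    (hcK : ((h.1 + 2, h.2 - 2) : Face) ∈ S) (θ : ℝ) :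
    ∀ (ω : ΩG (dom (boxMinus m n S)) (Face.side (h.1 + 1, h.2) .W) (farW (h.1 + 1, h.2))) (hb : ω.IsB2a),
      ω.2.firstSideG = .S →
      ω.WE (fun _ => θ) ≠ excursionWinding θ ω.2.firstSideG
        (ω.z1 (rootedFace_hroot_boxMinus_of_mem (farW_hroot_mem_boxMinus_of_not_mem hW (by omega) (by omega) hN hfS) hh)
          hb) ω.1 →
      ¬ω.2.W1FreeOff (farW (h.1 + 1, h.2)) := by
  intro ω hb hS' hW'
  have hhD : holeFaceW ((h.1 + 1, h.2) : Face) ∉ dom (boxMinus m n S) := by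
    rw [holeFaceW_hroot]; exact not_mem_dom_boxMinus_of_mem hh
  have hKD : killSE ((h.1 + 1, h.2) : Face) ∉ dom (boxMinus m n S) := by
    have e : killSE ((h.1 + 1, h.2) : Face) = (h.1 + 2, h.2 - 2) := Prod.ext (by simp only [killSE]; ring) rfl
    rw [e]; exact not_mem_dom_boxMinus_of_mem hcK
  rcases hbdry with h2 | h3
  · refine ΩG.not_W1FreeOff_farW_of_wound_under_killSE_column hhD hKD (Y := 0) (by simp only; omega)
      (fun y hy hy' => by simp only at hy'; omega) (fun f hf => ?_) ω _ hb hS' hW'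
    exact (mem_dom_boxMinus.1 hf).1.2.2.1
  · refine ΩG.not_W1FreeOff_farW_of_wound_under_killSE_eastWall hhD hKD (fun f hf => ?_) ω _ hb hS' hW'
    have := (mem_dom_boxMinus.1 hf).1.2.1
    simp only; omega

/-- ★★★★★ **ALL BOXES, ANY FURTHER DEFECTS: `K_S2 = (h.1 − 2, h.2 − 2)` REMOVED ON A WALL (`h.2 = 2`: bottom wall; or `h.1 = 2`:
west wall) ⇒ THE UNDER ROUTE IS `w₂`-KILLED** — every wound class-`B2a` under-walk at the far cell is `w₂`-marked off it.
[cite: GlazmanManolescu2019, §1 (the paragraph of Fig. 2), Lemma 2.1]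
[cite: Glazman2015WeightedSAW, Lemma 3.1 (proof, pp. 6–7)] [cite: CourantRobbins1958, Ch. V Appendix §2 (the even–odd rule)] -/
theorem lawL_box_killSW_wall_under_w2_killed (hW : 2 ≤ h.1) (hE : h.1 ≤ m) (hS2 : 2 ≤ h.2) (hN : h.2 + 1 ≤ n)
    (hbdry : h.2 = 2 ∨ h.1 = 2) (hh : h ∈ S) (hfS : ((h.1 - 1, h.2) : Face) ∉ S)
    (hcK : ((h.1 - 2, h.2 - 2) : Face) ∈ S) (θ : ℝ) :
    ∀ (ω : ΩG (dom (boxMinus m n S)) (Face.side (h.1 + 1, h.2) .W) (farW (h.1 + 1, h.2))) (hb : ω.IsB2a),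
      ω.2.firstSideG = .S →
      ω.WE (fun _ => θ) ≠ excursionWinding θ ω.2.firstSideG
        (ω.z1 (rootedFace_hroot_boxMinus_of_mem (farW_hroot_mem_boxMinus_of_not_mem (by omega) hE (by omega) hN hfS) hh)
          hb) ω.1 →
      ¬ω.2.W2FreeOff (farW (h.1 + 1, h.2)) := by
  intro ω hb hS' hW'
  have hhD : holeFaceW ((h.1 + 1, h.2) : Face) ∉ dom (boxMinus m n S) := by
    rw [holeFaceW_hroot]; exact not_mem_dom_boxMinus_of_mem hh
  have hKD : killSW ((h.1 + 1, h.2) : Face) ∉ dom (boxMinus m n S) := by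
    have e : killSW ((h.1 + 1, h.2) : Face) = (h.1 - 2, h.2 - 2) := Prod.ext (by simp only [killSW]; ring) rfl
    rw [e]; exact not_mem_dom_boxMinus_of_mem hcK
  rcases hbdry with h2 | h1
  · refine ΩG.not_W2FreeOff_farW_of_wound_under_killSW_column hhD hKD (Y := 0) (by simp only; omega)
      (fun y hy hy' => by simp only at hy'; omega) (fun f hf => ?_) ω _ hb hS' hW'
    exact (mem_dom_boxMinus.1 hf).1.2.2.1
  · refine ΩG.not_W2FreeOff_farW_of_wound_under_killSW_westWall hhD hKD (fun f hf => ?_) ω _ hb hS' hW'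
    have := (mem_dom_boxMinus.1 hf).1.1
    simp only; omega

end Boxes

end Literature.Barriers.CriticalPhenomena.PlaquetteWalk
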